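import Mathlib
import HarnessLib
import Summits.AtomisticToContinuum.FouriersLaw.Theorems.VanishingNoiseTransferNoisyFourierFlipCeilingField

/-!
# The Abel transfer, part 1: momentum-sign patterns, reversal, and the sector bound for the total current
# (helper `helper_abelTransferSectorBound` of stub `stub_abelTransfer`, line `abel-kapitza-even-corrector`,
# crux `VanishingNoiseTransfer.NoisyFourier`, stmt-AtomisticToContinuum-11977)

`--supports stmt-AtomisticToContinuum-11977` helper file (Aux1 of the file proving `stub_abelTransfer`).
General `L²` facts for a measure `μ` on phase space invariant under every single-site velocity flip
`F_i = momentumFlip i` (Bernardin–Olla 2011 §2.1):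

* `measurePreserving_boolFlip`, `memLp_patternAverage` — every momentum-sign pattern `p ↦ w·p` preserves `μ`,
  so the pattern average `P₀u = 2^{-L} Σ_w u(q, w·p)` of `u ∈ L²(μ)` is in `L²(μ)`;
* `flipNoise_rev`, `integral_rev_gibbsMeasure`, `totalCurrent_neg_momentum` — the flip noise commutes with the
  momentum reversal `Π(q,p) = (q,−p)`, Gibbs measures are `Π`-invariant, the total current is `Π`-odd;
* `abs_integral_mul_totalCurrent_le` — **the sector bound**: if the half currents `p_k V'(q_j − q_i)` are in
  `L²(μ)` with second moments `≤ M₁`, then for `u ∈ L²(μ)` and `δ > 0`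
  `|∫ u · Σ_i j_i dμ| ≤ (δ E(u) + L M₁/δ)/4`, `E(u) = Σ_k ∫ (u∘F_k − u)² dμ`: each half current is odd under ONE
  flip, so `(∫ u h)² ≤ ¼ ‖u∘F_k − u‖² ‖h‖²` (`sq_integral_mul_le_of_odd`), and every site carries at most two
  halves of each kind (Bernardin–Olla 2011 §3, the entropy-production mechanism);
* `integral_sq_le_of_split` — `‖u‖² ≤ 2‖Pu‖² + 2‖u − Pu‖²` bookkeeping;
* `helper_abelTransferSectorBound` — registered helper (notation-free restatement of the sector bound).

References: Bernardin–Olla 2011 §2.1, §3; folklore. No definitions.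
-/

noncomputable section

open MeasureTheory Filter Topology
open scoped BigOperators
open Literature.MathematicalPhysics.KineticTheory.HeatConduction
open Summit.AtomisticToContinuum.FouriersLaw.Theorems.SuperadditiveResistance.Kubo
  (rev rev_apply integral_rev_mul_gibbsDensity)
open Summit.AtomisticToContinuum.FouriersLaw.Theorems.NoisyFourier.FlipCeiling (sq_integral_mul_le_of_odd)

namespace Summit.AtomisticToContinuum.FouriersLaw.Cruxes.NoisyFourier.AbelKapitzaEvenCorrector

namespace AbelTransfer

/-! ## Momentum-sign patterns, reversal and the flip noise -/

section Patterns

variable {L : ℕ} {μ : Measure (PhaseSpace L)}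

/-- A finite set of velocity flips preserves every flip-invariant measure. [folklore] -/
theorem measurePreserving_finsetFlip (hμ : ∀ i, MeasurePreserving (momentumFlip i) μ μ) (s : Finset (Fin L)) :
    MeasurePreserving
      (fun x : PhaseSpace L => ((x.1, fun j => if j ∈ s then -x.2 j else x.2 j) : PhaseSpace L)) μ μ := by
  -- adapted from `NoiseLocality.StubNoisyPositive.ae_eq_comp_reversal_of_flips`
  -- (Theorems/VanishingNoiseTransferNoiseLocalityStubNoisyPositiveAux3.lean)
  classical
  induction s using Finset.induction_on with
  | empty =>
    have e : (fun x : PhaseSpace L =>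
        ((x.1, fun j => if j ∈ (∅ : Finset (Fin L)) then -x.2 j else x.2 j) : PhaseSpace L)) = id := by
      funext x
      simp only [Finset.notMem_empty, if_false, id_eq]
    rw [e]
    exact MeasurePreserving.id μ
  | insert i s hi ih =>
    have e : (fun x : PhaseSpace L => ((x.1, fun j => if j ∈ insert i s then -x.2 j else x.2 j) : PhaseSpace L)) =
        (momentumFlip i) ∘ fun x : PhaseSpace L =>
          ((x.1, fun j => if j ∈ s then -x.2 j else x.2 j) : PhaseSpace L) := by
      funext x
      refine Prod.ext rfl (funext fun j => ?_)
      simp only [Function.comp_apply, momentumFlip_apply, Finset.mem_insert]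
      by_cases hj : j = i
      · subst hj
        simp [hi]
      · simp [hj]
    rw [e]
    exact (hμ i).comp ih

/-- A momentum-sign pattern `p ↦ w·p` (`w ∈ {±1}^L`) preserves every flip-invariant measure. [folklore] -/
theorem measurePreserving_boolFlip (hμ : ∀ i, MeasurePreserving (momentumFlip i) μ μ) (w : Fin L → Bool) :
    MeasurePreserving
      (fun x : PhaseSpace L => ((x.1, fun i => if w i then -x.2 i else x.2 i) : PhaseSpace L)) μ μ := by
  have e : (fun x : PhaseSpace L => ((x.1, fun i => if w i then -x.2 i else x.2 i) : PhaseSpace L)) =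
      fun x : PhaseSpace L =>
        ((x.1, fun j => if j ∈ Finset.univ.filter (fun j => w j) then -x.2 j else x.2 j) : PhaseSpace L) := by
    funext x
    simp only [Finset.mem_filter, Finset.mem_univ, true_and]
  rw [e]
  exact measurePreserving_finsetFlip hμ _

/-- The average `P₀u` of an `L²` function over the `2^L` momentum-sign patterns is in `L²` (flip-invariant
measure). [folklore] -/
theorem memLp_patternAverage (hμ : ∀ i, MeasurePreserving (momentumFlip i) μ μ) {u : PhaseSpace L → ℝ}
    (hu : MemLp u 2 μ) :
    MemLp (fun x : PhaseSpace L =>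
      (∑ w : Fin L → Bool, u (x.1, fun i => if w i then -x.2 i else x.2 i)) / 2 ^ L) 2 μ := by
  have h : ∀ w : Fin L → Bool,
      MemLp (fun x : PhaseSpace L => u (x.1, fun i => if w i then -x.2 i else x.2 i)) 2 μ := fun w =>
    hu.comp_measurePreserving (measurePreserving_boolFlip hμ w)
  have hs := memLp_finsetSum (Finset.univ : Finset (Fin L → Bool)) (fun w _ => h w)
  have e : (fun x : PhaseSpace L =>
      (∑ w : Fin L → Bool, u (x.1, fun i => if w i then -x.2 i else x.2 i)) / 2 ^ L) =
      fun x : PhaseSpace L =>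
        (2 ^ L : ℝ)⁻¹ * ∑ w : Fin L → Bool, u (x.1, fun i => if w i then -x.2 i else x.2 i) := by
    funext x
    rw [div_eq_inv_mul]
  rw [e]
  exact hs.const_mul _

/-- A single velocity flip commutes with the full momentum reversal `Π(q,p) = (q,−p)`. [folklore] -/
theorem momentumFlip_neg_momentum (i : Fin L) (x : PhaseSpace L) :
    momentumFlip i ((x.1, -x.2) : PhaseSpace L) = ((momentumFlip i x).1, -(momentumFlip i x).2) := by
  refine Prod.ext rfl (funext fun j => ?_)
  by_cases hj : j = i
  · subst hj
    simp [momentumFlip]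
  · simp [momentumFlip, hj]

/-- The flip noise commutes with the momentum reversal: `S (rev f) = rev (S f)`. [folklore] -/
theorem flipNoise_rev (f : PhaseSpace L → ℝ) (x : PhaseSpace L) :
    flipNoise L (rev f) x = flipNoise L f (x.1, -x.2) := by
  simp only [flipNoise_eq, rev_apply, momentumFlip_neg_momentum, momentumFlip_fst]

/-- The Gibbs measure of any chain is invariant under the momentum reversal: `∫ F∘Π dμ_T = ∫ F dμ_T`.
[folklore] -/
theorem integral_rev_gibbsMeasure (P : OscillatorChain) (T : ℝ) (F : PhaseSpace L → ℝ) :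
    ∫ x, F (x.1, -x.2) ∂(P.gibbsMeasure L T) = ∫ x, F x ∂(P.gibbsMeasure L T) := by
  rw [P.integral_gibbsMeasure, P.integral_gibbsMeasure]
  congr 1
  exact integral_rev_mul_gibbsDensity P T F

/-- The total current is odd under the momentum reversal. [folklore] -/
theorem totalCurrent_neg_momentum (P : OscillatorChain) (x : PhaseSpace L) :
    (∑ i, P.bondCurrent L i ((x.1, -x.2) : PhaseSpace L)) = -∑ i, P.bondCurrent L i x := by
  simp only [OscillatorChain.bondCurrent_neg_momentum, Finset.sum_neg_distrib]

end Patterns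

/-! ## The sector bound: pairing an `L²` function with the total current -/

section Pairing

variable {L : ℕ}

/-- At most one site is the right neighbour of a given site. [folklore] -/
theorem sum_ite_succ_le_one (i : Fin L) : (∑ j : Fin L, if j.val = i.val + 1 then (1 : ℝ) else 0) ≤ 1 := by
  rw [Finset.sum_boole]
  have h : (Finset.univ.filter fun j : Fin L => j.val = i.val + 1).card ≤ 1 :=
    Finset.card_le_one.2 fun a ha b hb => by
      simp only [Finset.mem_filter, Finset.mem_univ, true_and] at ha hb
      exact Fin.ext (by omega)
  exact_mod_cast h

/-- At most one site is the left neighbour of a given site. [folklore] -/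
theorem sum_ite_pred_le_one (j : Fin L) : (∑ i : Fin L, if j.val = i.val + 1 then (1 : ℝ) else 0) ≤ 1 := by
  rw [Finset.sum_boole]
  have h : (Finset.univ.filter fun i : Fin L => j.val = i.val + 1).card ≤ 1 :=
    Finset.card_le_one.2 fun a ha b hb => by
      simp only [Finset.mem_filter, Finset.mem_univ, true_and] at ha hb
      exact Fin.ext (by omega)
  exact_mod_cast h

/-- Squared-integral comparison: `t² ≤ d m / 4` gives `|t| ≤ (δ d + m/δ)/4` for `δ > 0`, `d ≥ 0`. [folklore] -/
theorem abs_le_of_sq_le_quarter_mul {t d m δ : ℝ} (hδ : 0 < δ) (hd : 0 ≤ d) (hm : 0 ≤ m)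
    (h : t ^ 2 ≤ 1 / 4 * d * m) : |t| ≤ (δ * d + m / δ) / 4 := by
  have hB0 : 0 ≤ (δ * d + m / δ) / 4 := by positivity
  refine abs_le_of_sq_le_sq ?_ hB0
  have key : ((δ * d + m / δ) / 4) ^ 2 - 1 / 4 * d * m = ((δ * d - m / δ) / 4) ^ 2 := by
    field_simp
    ring
  nlinarith [sq_nonneg ((δ * d - m / δ) / 4), key]

/-- **Sector bound.** For a measure `μ` invariant under every velocity flip, half currents
`p_k V'(q_j − q_i) ∈ L²(μ)` with second moments `≤ M₁`, `u ∈ L²(μ)` and `δ > 0`: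
`|∫ u · Σ_i j_i dμ| ≤ (δ E(u) + L M₁/δ)/4`, `E(u) = Σ_k ∫ (u∘F_k − u)² dμ` — each half current is odd under ONE
flip (`sq_integral_mul_le_of_odd`), and every site carries at most two halves of each kind.
[cite: BernardinOlla2011, §3] -/
theorem abs_integral_mul_totalCurrent_le (P : OscillatorChain) {μ : Measure (PhaseSpace L)}
    (hμ : ∀ i, MeasurePreserving (momentumFlip i) μ μ) {M₁ : ℝ}
    (hM : ∀ k i j : Fin L, MemLp (fun x : PhaseSpace L => x.2 k * deriv P.V (x.1 j - x.1 i)) 2 μ ∧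
      ∫ x, (x.2 k * deriv P.V (x.1 j - x.1 i)) ^ 2 ∂μ ≤ M₁)
    {u : PhaseSpace L → ℝ} (hu : MemLp u 2 μ) {δ : ℝ} (hδ : 0 < δ) :
    |∫ x, u x * (∑ i, P.bondCurrent L i x) ∂μ| ≤
      (δ * ∑ i, ∫ x, (u (momentumFlip i x) - u x) ^ 2 ∂μ + L * M₁ / δ) / 4 := by
  rcases Nat.eq_zero_or_pos L with hL0 | hL0
  · subst hL0
    simp
  have hM0 : 0 ≤ M₁ := (integral_nonneg fun x => sq_nonneg _).trans (hM ⟨0, hL0⟩ ⟨0, hL0⟩ ⟨0, hL0⟩).2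
  set d : Fin L → ℝ := fun k => ∫ x, (u (momentumFlip k x) - u x) ^ 2 ∂μ with hd
  have hd0 : ∀ k, 0 ≤ d k := fun k => integral_nonneg fun x => sq_nonneg _
  -- the half currents
  set a : Fin L → Fin L → PhaseSpace L → ℝ := fun i j x => x.2 i * deriv P.V (x.1 j - x.1 i) with ha
  set b : Fin L → Fin L → PhaseSpace L → ℝ := fun i j x => x.2 j * deriv P.V (x.1 j - x.1 i) with hb
  have haL : ∀ i j, MemLp (a i j) 2 μ := fun i j => (hM i i j).1
  have hbL : ∀ i j, MemLp (b i j) 2 μ := fun i j => (hM j i j).1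
  have haM : ∀ i j, ∫ x, a i j x ^ 2 ∂μ ≤ M₁ := fun i j => (hM i i j).2
  have hbM : ∀ i j, ∫ x, b i j x ^ 2 ∂μ ≤ M₁ := fun i j => (hM j i j).2
  -- pairing with a half current odd under the flip `F_k`
  have hhalf : ∀ (k : Fin L) (h : PhaseSpace L → ℝ), MemLp h 2 μ → (∫ x, h x ^ 2 ∂μ ≤ M₁) →
      (∀ x, h (momentumFlip k x) = -h x) → |∫ x, u x * h x ∂μ| ≤ (δ * d k + M₁ / δ) / 4 := by
    intro k h hh hhM hodd
    refine abs_le_of_sq_le_quarter_mul hδ (hd0 k) hM0 ((sq_integral_mul_le_of_odd (hμ k) hu hh hodd).trans ?_)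
    have : 0 ≤ 1 / 4 * d k := by have := hd0 k; positivity
    simpa only [hd] using mul_le_mul_of_nonneg_left hhM this
  -- the bond weights `[j = i + 1]`
  set w : Fin L → Fin L → ℝ := fun i j => if j.val = i.val + 1 then 1 else 0 with hw
  have hw0 : ∀ i j, 0 ≤ w i j := fun i j => by
    simp only [hw]
    split_ifs <;> norm_num
  have hwi : ∀ i, ∑ j, w i j ≤ 1 := fun i => sum_ite_succ_le_one i
  have hwj : ∀ j, ∑ i, w i j ≤ 1 := fun j => sum_ite_pred_le_one j
  -- decomposition of `u j_i` into halves
  have hdec : ∀ i x, u x * P.bondCurrent L i x = ∑ j, w i j * (-(1 / 2) * (u x * a i j x + u x * b i j x)) := by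
    intro i x
    unfold OscillatorChain.bondCurrent
    rw [Finset.mul_sum]
    refine Finset.sum_congr rfl fun j _ => ?_
    simp only [hw, ha, hb]
    split_ifs <;> ring
  have hI : ∀ i j, Integrable (fun x => w i j * (-(1 / 2) * (u x * a i j x + u x * b i j x))) μ := fun i j =>
    (((hu.integrable_mul (haL i j)).add (hu.integrable_mul (hbL i j))).const_mul (-(1 / 2))).const_mul (w i j)
  have hfun : ∀ i, (fun x => u x * P.bondCurrent L i x) =
      fun x => ∑ j, w i j * (-(1 / 2) * (u x * a i j x + u x * b i j x)) := fun i => funext (hdec i)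
  have hIi : ∀ i, Integrable (fun x => u x * P.bondCurrent L i x) μ := fun i => by
    rw [hfun i]
    exact integrable_finsetSum _ fun j _ => hI i j
  -- the pairing as a double sum over bonds
  set c : Fin L → Fin L → ℝ := fun i j => -(1 / 2) * ((∫ x, u x * a i j x ∂μ) + ∫ x, u x * b i j x ∂μ) with hc
  have hsum : ∫ x, u x * (∑ i, P.bondCurrent L i x) ∂μ = ∑ i, ∑ j, w i j * c i j := by
    simp_rw [Finset.mul_sum]
    rw [integral_finsetSum _ fun i _ => hIi i]
    refine Finset.sum_congr rfl fun i _ => ?_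
    rw [hfun i, integral_finsetSum _ fun j _ => hI i j]
    refine Finset.sum_congr rfl fun j _ => ?_
    have ia : Integrable (fun x => u x * a i j x) μ := hu.integrable_mul (haL i j)
    have ib : Integrable (fun x => u x * b i j x) μ := hu.integrable_mul (hbL i j)
    rw [integral_const_mul, integral_const_mul, integral_add ia ib]
  -- each bond: `|c_ij| ≤ (δ(d_i + d_j) + 2M₁/δ)/8`
  have hcb : ∀ i j, |c i j| ≤ (δ * (d i + d j) + 2 * M₁ / δ) / 8 := by
    intro i j
    have h1 := hhalf i (a i j) (haL i j) (haM i j) fun x => by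
      simp only [ha, momentumFlip_fst, momentumFlip_snd_self]; ring
    have h2 := hhalf j (b i j) (hbL i j) (hbM i j) fun x => by
      simp only [hb, momentumFlip_fst, momentumFlip_snd_self]; ring
    have h3 := abs_add_le (∫ x, u x * a i j x ∂μ) (∫ x, u x * b i j x ∂μ)
    have h4 : 2 * M₁ / δ = 2 * (M₁ / δ) := by ring
    simp only [hc]
    rw [abs_mul, abs_neg, abs_of_pos (by norm_num : (0 : ℝ) < 1 / 2)]
    linarith
  -- summation over the bonds
  have habs : |∑ i, ∑ j, w i j * c i j| ≤ ∑ i, ∑ j, w i j * ((δ * (d i + d j) + 2 * M₁ / δ) / 8) := by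
    refine (Finset.abs_sum_le_sum_abs _ _).trans (Finset.sum_le_sum fun i _ => ?_)
    refine (Finset.abs_sum_le_sum_abs _ _).trans (Finset.sum_le_sum fun j _ => ?_)
    rw [abs_mul, abs_of_nonneg (hw0 i j)]
    exact mul_le_mul_of_nonneg_left (hcb i j) (hw0 i j)
  have hsplit : ∑ i, ∑ j, w i j * ((δ * (d i + d j) + 2 * M₁ / δ) / 8) =
      δ / 8 * (∑ i, ∑ j, w i j * d i) + δ / 8 * (∑ i, ∑ j, w i j * d j) +
        M₁ / (4 * δ) * ∑ i, ∑ j, w i j := by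
    have e : ∀ i j, w i j * ((δ * (d i + d j) + 2 * M₁ / δ) / 8) =
        δ / 8 * (w i j * d i) + δ / 8 * (w i j * d j) + M₁ / (4 * δ) * w i j := fun i j => by ring
    simp only [e, Finset.sum_add_distrib, ← Finset.mul_sum]
  have hS1 : ∑ i, ∑ j, w i j * d i ≤ ∑ i, d i := by
    refine Finset.sum_le_sum fun i _ => ?_
    rw [← Finset.sum_mul]
    calc (∑ j, w i j) * d i ≤ 1 * d i := mul_le_mul_of_nonneg_right (hwi i) (hd0 i)
      _ = d i := one_mul _
  have hS2 : ∑ i, ∑ j, w i j * d j ≤ ∑ j, d j := by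
    rw [Finset.sum_comm]
    refine Finset.sum_le_sum fun j _ => ?_
    rw [← Finset.sum_mul]
    calc (∑ i, w i j) * d j ≤ 1 * d j := mul_le_mul_of_nonneg_right (hwj j) (hd0 j)
      _ = d j := one_mul _
  have hS3 : ∑ i, ∑ j, w i j ≤ L := by
    calc ∑ i, ∑ j, w i j ≤ ∑ _i : Fin L, (1 : ℝ) := Finset.sum_le_sum fun i _ => hwi i
      _ = L := by simp
  have e1 := mul_le_mul_of_nonneg_left hS1 (by positivity : (0 : ℝ) ≤ δ / 8)
  have e2 := mul_le_mul_of_nonneg_left hS2 (by positivity : (0 : ℝ) ≤ δ / 8)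
  have e3 := mul_le_mul_of_nonneg_left hS3 (by positivity : (0 : ℝ) ≤ M₁ / (4 * δ))
  rw [hsum]
  rw [hsplit] at habs
  have e4 : M₁ / (4 * δ) * (L : ℝ) = (L : ℝ) * M₁ / δ / 4 := by
    field_simp
  have e5 : δ / 8 * (∑ i, d i) + δ / 8 * (∑ j, d j) = δ * (∑ i, d i) / 4 := by ring
  linarith

end Pairing

/-! ## `L²` bookkeeping -/

section Split

variable {X : Type*} [MeasurableSpace X] {μ : Measure X}

/-- `‖u‖² ≤ 2‖P u‖² + 2‖u − P u‖²`, with the two norms bounded by a gap and a size hypothesis. [folklore] -/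
theorem integral_sq_le_of_split {u p : X → ℝ} (hu : MemLp u 2 μ) (hp : MemLp p 2 μ) {E A : ℝ}
    (hgap : 4 * ∫ x, (u x - p x) ^ 2 ∂μ ≤ E) (hkap : ∫ x, (p x) ^ 2 ∂μ ≤ A) :
    ∫ x, u x ^ 2 ∂μ ≤ 2 * A + E / 2 := by
  have h1 : Integrable (fun x => p x ^ 2) μ := hp.integrable_sq
  have h2 : Integrable (fun x => (u x - p x) ^ 2) μ := (hu.sub hp).integrable_sq
  have hpt : ∀ x, u x ^ 2 ≤ 2 * p x ^ 2 + 2 * (u x - p x) ^ 2 := fun x => by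
    nlinarith [sq_nonneg (u x - 2 * p x)]
  calc ∫ x, u x ^ 2 ∂μ ≤ ∫ x, 2 * p x ^ 2 + 2 * (u x - p x) ^ 2 ∂μ :=
        integral_mono hu.integrable_sq ((h1.const_mul 2).add (h2.const_mul 2)) hpt
    _ = 2 * (∫ x, p x ^ 2 ∂μ) + 2 * ∫ x, (u x - p x) ^ 2 ∂μ := by
        rw [integral_add (h1.const_mul 2) (h2.const_mul 2), integral_const_mul, integral_const_mul]
    _ ≤ 2 * A + E / 2 := by linarith

end Split

end AbelTransfer

/-! ## Registered helper -/

/-- Registered helper sub-goal `helper_abelTransferSectorBound` of stub `stub_abelTransfer` (line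
`abel-kapitza-even-corrector`, crux stmt-AtomisticToContinuum-11977): the sector bound
`|∫ u · Σ_i j_i dμ| ≤ (δ Σ_k ∫ (u∘F_k − u)² dμ + L M₁/δ)/4` for a flip-invariant `μ`, half currents with second
moments `≤ M₁`, `u ∈ L²(μ)`, `δ > 0` (`AbelTransfer.abs_integral_mul_totalCurrent_le`, notation-free restatement).
[cite: BernardinOlla2011, §3] -/
theorem helper_abelTransferSectorBound : ∀ (L : ℕ) (P : Literature.MathematicalPhysics.KineticTheory.HeatConduction.OscillatorChain) (μ : MeasureTheory.Measure (Literature.MathematicalPhysics.KineticTheory.HeatConduction.PhaseSpace L)), (∀ i : Fin L, MeasureTheory.MeasurePreserving (Literature.MathematicalPhysics.KineticTheory.HeatConduction.momentumFlip i) μ μ) → ∀ (M₁ : ℝ), (∀ k i j : Fin L, MeasureTheory.MemLp (fun x : Literature.MathematicalPhysics.KineticTheory.HeatConduction.PhaseSpace L => x.2 k * deriv P.V (x.1 j - x.1 i)) 2 μ ∧ MeasureTheory.integral μ (fun x => (x.2 k * deriv P.V (x.1 j - x.1 i)) ^ 2) ≤ M₁) → ∀ (u : Literature.MathematicalPhysics.KineticTheory.HeatConduction.PhaseSpace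 L → ℝ), MeasureTheory.MemLp u 2 μ → ∀ (δ : ℝ), 0 < δ → |MeasureTheory.integral μ (fun x => u x * ∑ i : Fin L, P.bondCurrent L i x)| ≤ (δ * ∑ i : Fin L, MeasureTheory.integral μ (fun x => (u (Literature.MathematicalPhysics.KineticTheory.HeatConduction.momentumFlip i x) - u x) ^ 2) + (L : ℝ) * M₁ / δ) / 4 :=
  fun _ P _ hμ _ hM _ hu _ hδ => AbelTransfer.abs_integral_mul_totalCurrent_le P hμ hM hu hδ

end Summit.AtomisticToContinuum.FouriersLaw.Cruxes.NoisyFourier.AbelKapitzaEvenCorrector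

end
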